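import Literature.NumberTheory.Automorphic.ResGLnCuspidalCohomologyApexSubmodule
import Literature.NumberTheory.Automorphic.AutomorphicFormsGKModuleProofs
import Literature.NumberTheory.Automorphic.AutomorphicRepLieActionGL
import Literature.NumberTheory.Automorphic.AutomorphicRepAdmissibilityProofs
import Literature.NumberTheory.Automorphic.HarishChandraFinitenessGL
import Literature.NumberTheory.Automorphic.HarishChandraGLParameterOfCharacter
import Literature.NumberTheory.Automorphic.GL2CCuspFormOps
import HarnessLib

/-!
# The `(𝔤, K_∞)`-module `W^{K(𝔫)}` of a clean cuspidal `π`: `(𝔤, K_∞)`-module axioms, admissibility,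
# essential unitarity and archimedean parameter

Topic `NumberTheory/Automorphic`; namespace `Literature.NumberTheory.Automorphic` (generic transfer
lemmas) and `….ConeDictionary` (vocabulary of `ResGLnCuspidalCohomologyApexModule`: `invW π h𝔫 =
W^{K(𝔫)} = e_{K(𝔫)} W` with `invKRep`, `invLie`).  Theorems only; no definition, no named fact,
no `sorry`.

The entry point `Clozel1990_exists_basic_levelFixed_cocycle_of_nonzero_moduleCochain`
(`ResGLnCuspidalCohomologyApexSubmodule`) of the Kuga reduction of the apex fact
`Clozel1990_exists_basic_levelFixed_cocycle` is fed with the module `V = W^{K(𝔫)}`; to apply to it an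
archimedean statement about `(𝔤, K_∞)`-MODULES (the Vogan–Zuckerman / Salamanca-Riba existence of
cohomology for unitary modules with the infinitesimal character of `E_λ^∨`, or Clozel's Lemme 3.14)
one needs `V` as an honest object of that theory.  This file records, for a clean (`W' = ⊥`)
cuspidal `π` of `GL_n(𝔸_K)` and `𝔫 ≠ 0`:

* `IsGKModule.of_equiv_to`, `ConeDictionary.isGKModule_W`, **`ConeDictionary.isGKModule_invW`** —
  `W` and `W^{K(𝔫)}` with right translation by `K_∞` and the Lie derivatives are `(𝔤, K_∞)`-modules
  (`K_∞`-finite, weakly continuous, `Ad`-compatible, `ρ𝔤|_𝔨 = dρK`): transfer of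
  `AutomorphicRepData.isGKModule_of_hasLieAction_holds` (Borel–Jacquet 4.6, on `W / W'`) along
  `W ≅ W / ⊥` and restriction to the stable subspace (`GKSubmodule.isGKModule_sub`)
  [cite: BorelJacquet1979, 4.6] [cite: BorelWallach2000, 0 §2.5];
* **`ConeDictionary.isAdmissibleGK_invKRep`** — `W^{K(𝔫)}` is an admissible `K_∞`-module
  (`automorphicRep_isAdmissible_holds`: `(W / W')^{K(𝔫)}` is admissible, Borel–Jacquet 4.5 with
  Harish-Chandra's finiteness theorem; `W^{K(𝔫)} ↪ (W / ⊥)^{K(𝔫)}`) [cite: BorelJacquet1979, 4.5];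
* `UniversalEnvelopingAlgebra.apply_lift_of_comm`, `HasCentralCharacter.of_injective`,
  `HasHCParameter.of_injective`, `HasArchParameter.of_injective` — central characters,
  Harish-Chandra parameters and archimedean parameters pass to a module INJECTING equivariantly into
  a module that has them (`U(𝔤)` is generated by `𝔤`) [cite: Knapp2002, Thm. 5.44];
  **`ConeDictionary.hasArchParameter_invLie`** — `W^{K(𝔫)}` has the archimedean parameter of `π`
  [cite: Clozel1990, §3.3];
* **`ConeDictionary.exists_isPosForm_invW`** — `W^{K(𝔫)}` carries a positive definite Hermitian
  form for which every `X ∈ 𝔤` of norm exponent `∑_{v real} tr X_v + ∑_{v complex} 2 re tr X_v = 0`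
  acts skew-adjointly (the unitarily normalised Petersson form, `CuspidalPeterssonForm`)
  [cite: Borel1997, 11.12 (2)] [cite: BorelJacquetCorvallis1979, 5.7];
* `ConeDictionary.invLie_centerOne` — `Z = 1` acts on `W^{K(𝔫)}` by the scalar by which it acts on
  `W`.

## References

* A. Borel, H. Jacquet, *Automorphic forms and automorphic representations*, Proc. Sympos. Pure
  Math. 33.1 (1979), 4.5–4.6, 5.7. [BorelJacquet1979] [BorelJacquetCorvallis1979]
* A. Borel, N. Wallach (2000), 0 §2.5, I §5.1 (held). [BorelWallach2000]
* A. W. Knapp, *Lie Groups Beyond an Introduction* (2002), Thm. 5.44. [Knapp2002]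
* L. Clozel, *Motifs et formes automorphes* (1990), §3.3, §3.5. [Clozel1990]
* A. Borel, *Automorphic forms on `SL₂(ℝ)`* (1997), 11.12 (2). [Borel1997]
-/

noncomputable section

-- Mathlib idiom (Mathlib/Algebra/Lie/OfAssociative.lean), as in `GKModules`: commutator brackets on
-- matrix algebras and on `Module.End ℂ V`
attribute [local instance 100] LieRing.ofAssociativeRing

open scoped TensorProduct Classical _root_.Matrix
open _root_.NumberField _root_.NumberField.InfinitePlace _root_.NumberField.mixedEmbedding IsDedekindDomain

namespace Literature.NumberTheory.Automorphic

/-! ### Transfer of the `(𝔤, K)`-module axioms along an equivariant isomorphism -/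

section Transfer

variable {A : Type*} [NormedCommRing A] [NormedAlgebra ℝ A] [NormedAlgebra ℚ A] [CompleteSpace A]
  [StarRing A] [StarModule ℝ A] [ContinuousStar A] {N : Type*} [Fintype N] [DecidableEq N]
  {G : RealMatrixGroup A N}
  {V V' : Type*} [AddCommGroup V] [Module ℂ V] [AddCommGroup V'] [Module ℂ V']
  {ρK : Representation ℂ G.maximalCompact V} {ρ𝔤 : G.lie →ₗ⁅ℝ⁆ Module.End ℂ V}
  {ρK' : Representation ℂ G.maximalCompact V'} {ρ𝔤' : G.lie →ₗ⁅ℝ⁆ Module.End ℂ V'}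

/-- **The `(𝔤, K)`-module axioms transfer along an equivariant linear isomorphism** `e : V' ≃ V` into a
`(𝔤, K)`-module `V` (`e ∘ ρK' = ρK ∘ e`, `e ∘ ρ𝔤' = ρ𝔤 ∘ e`). [cite: BorelWallach2000, 0 §2.5] -/
theorem IsGKModule.of_equiv_to (h : IsGKModule G ρK ρ𝔤) (e : V' ≃ₗ[ℂ] V)
    (heK : ∀ (k : G.maximalCompact) (v : V'), e (ρK' k v) = ρK k (e v))
    (he𝔤 : ∀ (X : G.lie) (v : V'), e (ρ𝔤' X v) = ρ𝔤 X (e v)) : IsGKModule G ρK' ρ𝔤' := by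
  have heK' : ∀ (k : G.maximalCompact) (v : V'), ρK' k v = e.symm (ρK k (e v)) := fun k v => by
    rw [← heK, LinearEquiv.symm_apply_apply]
  have he𝔤' : ∀ (X : G.lie) (v : V'), ρ𝔤' X v = e.symm (ρ𝔤 X (e v)) := fun X v => by
    rw [← he𝔤, LinearEquiv.symm_apply_apply]
  refine ⟨fun v => ?_, fun v ℓ => ?_, fun k X => ?_, fun X v ℓ => ?_⟩
  · -- `K`-finiteness: the orbit span is the image under `e⁻¹` of the orbit span of `e v`
    haveI := h.kFinite (e v)
    have hle : Submodule.span ℂ (Set.range fun k : G.maximalCompact => ρK' k v) ≤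
        (Submodule.span ℂ (Set.range fun k : G.maximalCompact => ρK k (e v))).map e.symm.toLinearMap := by
      rw [Submodule.map_span]
      refine Submodule.span_mono ?_
      rintro _ ⟨k, rfl⟩
      exact ⟨ρK k (e v), ⟨k, rfl⟩, (heK' k v).symm⟩
    exact Submodule.finiteDimensional_of_le hle
  · -- weak continuity
    have hfun : (fun k : G.maximalCompact => ℓ (ρK' k v)) =
        fun k => (ℓ ∘ₗ e.symm.toLinearMap) (ρK k (e v)) := by
      funext k; rw [heK']; rfl
    rw [hfun]
    exact h.weaklyContinuous (e v) _
  · -- `Ad`-compatibility, pointwise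
    refine LinearMap.ext fun v => ?_
    simp only [LinearMap.coe_comp, Function.comp_apply]
    rw [heK', he𝔤', heK', LinearEquiv.apply_symm_apply, LinearEquiv.apply_symm_apply, he𝔤']
    congr 1
    have hc := LinearMap.congr_fun (h.ad_compat k X) (e v)
    simp only [LinearMap.coe_comp, Function.comp_apply] at hc
    exact hc
  · -- weak derivative of `ρK'` along `𝔨`
    have hfun : (fun t : ℝ => ℓ (ρK' (G.expK (t • X)) v)) =
        fun t => (ℓ ∘ₗ e.symm.toLinearMap) (ρK (G.expK (t • X)) (e v)) := by
      funext t; rw [heK']; rfl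
    have hval : ℓ (ρ𝔤' (LieSubalgebra.inclusion G.compactLie_le_lie X) v) =
        (ℓ ∘ₗ e.symm.toLinearMap) (ρ𝔤 (LieSubalgebra.inclusion G.compactLie_le_lie X) (e v)) := by
      rw [he𝔤']; rfl
    rw [hfun, hval]
    exact h.hasWeakDeriv X (e v) _

end Transfer

/-! ### Central characters and parameters of a module injecting equivariantly -/

section Inject

variable {L : Type*} [LieRing L] [LieAlgebra ℝ L] {V V' : Type*} [AddCommGroup V] [Module ℂ V]
  [AddCommGroup V'] [Module ℂ V']

/-- **`U(𝔤)` through an intertwiner**: if `j ∘ ρ'(X) = ρ(X) ∘ j` for all `X ∈ 𝔤` then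
`j (u · v) = u · (j v)` for all `u ∈ U(𝔤)` (`U(𝔤)` is generated by `𝔤`). [folklore] -/
theorem UniversalEnvelopingAlgebra.apply_lift_of_comm (ρ : L →ₗ⁅ℝ⁆ Module.End ℂ V)
    (ρ' : L →ₗ⁅ℝ⁆ Module.End ℂ V') (j : V' →ₗ[ℂ] V) (hj : ∀ (X : L) (v : V'), j (ρ' X v) = ρ X (j v))
    (u : UniversalEnvelopingAlgebra ℝ L) (v : V') :
    j (UniversalEnvelopingAlgebra.lift ℝ ρ' u v) = UniversalEnvelopingAlgebra.lift ℝ ρ u (j v) := by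
  induction u using UniversalEnvelopingAlgebra.induction_on' generalizing v with
  | algebraMap r =>
    rw [AlgHom.commutes, AlgHom.commutes, Algebra.algebraMap_eq_smul_one, Algebra.algebraMap_eq_smul_one,
      LinearMap.smul_apply, LinearMap.smul_apply, Module.End.one_apply, Module.End.one_apply,
      LinearMap.map_smul_of_tower]
  | ι x => rw [UniversalEnvelopingAlgebra.lift_ι_apply, UniversalEnvelopingAlgebra.lift_ι_apply, hj]
  | mul a b ha hb => rw [map_mul, map_mul, Module.End.mul_apply, Module.End.mul_apply, ha, hb]
  | add a b ha hb => rw [map_add, map_add, LinearMap.add_apply, LinearMap.add_apply, map_add, ha, hb]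

/-- **A central character passes to a module injecting equivariantly.** [cite: Knapp2002, Thm. 5.44] -/
theorem HasCentralCharacter.of_injective {ρ : L →ₗ⁅ℝ⁆ Module.End ℂ V}
    {θ : Subalgebra.center ℝ (UniversalEnvelopingAlgebra ℝ L) →ₐ[ℝ] ℂ} (h : HasCentralCharacter ρ θ)
    {ρ' : L →ₗ⁅ℝ⁆ Module.End ℂ V'} (j : V' →ₗ[ℂ] V) (hj : ∀ (X : L) (v : V'), j (ρ' X v) = ρ X (j v))
    (hinj : Function.Injective j) : HasCentralCharacter ρ' θ := by
  intro z
  refine LinearMap.ext fun v => hinj ?_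
  rw [UniversalEnvelopingAlgebra.apply_lift_of_comm ρ ρ' j hj, h z, Module.algebraMap_end_apply,
    Module.algebraMap_end_apply, map_smul]

/-- **A Harish-Chandra parameter passes to a module injecting equivariantly** (`𝔤𝔩ₙ(𝕜)`-modules).
[cite: Knapp2002, Thm. 5.44] -/
theorem HasHCParameter.of_injective {𝕜 : Type*} [RCLike 𝕜] {n : ℕ}
    {ρ : Matrix (Fin n) (Fin n) 𝕜 →ₗ⁅ℝ⁆ Module.End ℂ V} {χ : (𝕜 →ₐ[ℝ] ℂ) → Multiset ℂ}
    (h : HasHCParameter ρ χ) {ρ' : Matrix (Fin n) (Fin n) 𝕜 →ₗ⁅ℝ⁆ Module.End ℂ V'} (j : V' →ₗ[ℂ] V)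
    (hj : ∀ (X : Matrix (Fin n) (Fin n) 𝕜) (v : V'), j (ρ' X v) = ρ X (j v)) (hinj : Function.Injective j) :
    HasHCParameter ρ' χ := by
  obtain ⟨hcard, θ, hθ, hγ⟩ := h
  exact ⟨hcard, θ, hθ.of_injective j hj hinj, hγ⟩

/-- **An archimedean parameter of `𝔤𝔩ₙ(K_∞)` passes to a module injecting equivariantly.**
[cite: Clozel1990, §3.3] -/
theorem HasArchParameter.of_injective {K : Type*} [Field K] {n : ℕ}
    {ρ : Matrix (Fin n) (Fin n) (mixedSpace K) →ₗ⁅ℝ⁆ Module.End ℂ V} {χ : (K →+* ℂ) → Multiset ℂ}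
    (h : Automorphic.HasArchParameter ρ χ) {ρ' : Matrix (Fin n) (Fin n) (mixedSpace K) →ₗ⁅ℝ⁆ Module.End ℂ V'}
    (j : V' →ₗ[ℂ] V) (hj : ∀ (X : Matrix (Fin n) (Fin n) (mixedSpace K)) (v : V'), j (ρ' X v) = ρ X (j v))
    (hinj : Function.Injective j) : Automorphic.HasArchParameter ρ' χ :=
  ⟨fun w => (h.1 w).of_injective j (fun X v => hj (realPlaceLie n w X) v) hinj,
    fun w => (h.2 w).of_injective j (fun X v => hj (complexPlaceLie n w X) v) hinj⟩

end Inject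

/-! ### The `(𝔤, K_∞)`-module `W^{K(𝔫)}` of a clean cuspidal `π` -/

namespace ConeDictionary

open ResGLnCohomology RealMatrixGroup

variable {n : ℕ} {K : Type} [Field K] [NumberField K] {hcpt : isCompact_glFiniteIntegralLevel n K}
  (π : AutomorphicRepData (AutomorphyDatum.gl n K hcpt)) {𝔫 : Ideal (𝓞 K)} (h𝔫 : 𝔫 ≠ 0)

/-- For `W' = ⊥` the projection `W → W / W'` is injective (`AutomorphicRepData.kerQuot_eq_bot`). [folklore] -/
theorem mkQ_injective (hW' : π.W' = ⊥) : Function.Injective π.mkQ := by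
  rw [← LinearMap.ker_eq_bot]
  change LinearMap.ker π.kerQuot.mkQ = ⊥
  rw [Submodule.ker_mkQ, π.kerQuot_eq_bot hW']

set_option maxHeartbeats 400000 in
-- the datum's towers
/-- **`W` (clean `π`, `W' = ⊥`) with right translation by `K_∞` and the Lie derivatives is a
`(𝔤, K_∞)`-module** (Borel–Jacquet 4.6 on `W / W'`, transported along `W ≅ W / ⊥`).
[cite: BorelJacquet1979, 4.6] -/
theorem isGKModule_W (hW' : π.W' = ⊥) : IsGKModule (AutomorphyDatum.gl n K hcpt).arch π.kRepW π.lieRepW := by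
  have h := π.isGKModule_of_hasLieAction_holds (AutomorphyDatum.isRegular_gl hcpt) π.hasLieAction_lieRep
  refine h.of_equiv_to (π.kerQuot.quotEquivOfEqBot (π.kerQuot_eq_bot hW')).symm (fun k v => ?_) (fun X v => ?_)
  · rw [Submodule.quotEquivOfEqBot_symm_apply, Submodule.quotEquivOfEqBot_symm_apply]
    rfl
  · rw [Submodule.quotEquivOfEqBot_symm_apply, Submodule.quotEquivOfEqBot_symm_apply]
    rfl

set_option maxHeartbeats 400000 in
-- the datum's towers
/-- **`W^{K(𝔫)}` is a `(𝔤, K_∞)`-module** (a `(𝔤, K_∞)`-stable subspace of `W`).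
[cite: BorelWallach2000, 0 §2.5, I §5.1] -/
theorem isGKModule_invW (hW' : π.W' = ⊥) :
    IsGKModule (AutomorphyDatum.gl n K hcpt).arch (invKRep π h𝔫) (invLie π h𝔫) :=
  GKSubmodule.isGKModule_sub (AutomorphyDatum.gl n K hcpt).arch π.kRepW π.lieRepW (invW π h𝔫)
    (invW_le_comap_kRepW π h𝔫) (invW_le_comap_lieRepW π h𝔫) (isGKModule_W π hW')

set_option maxHeartbeats 400000 in
-- the datum's towers
/-- **`W^{K(𝔫)}` is an admissible `K_∞`-module**: it injects `K_∞`-equivariantly into the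
`K(𝔫)`-fixed vectors of `W / W'`, which form an admissible `K_∞`-module (Borel–Jacquet 4.5 with
Harish-Chandra's finiteness theorem, `automorphicRep_isAdmissible_holds`). [cite: BorelJacquet1979, 4.5] -/
theorem isAdmissibleGK_invKRep (hW' : π.W' = ⊥) : IsAdmissibleGK (invKRep π h𝔫) := by
  have hadm : IsAdmissibleGK (π.kRepFixed (levelFin n K hcpt 𝔫)) :=
    (automorphicRep_isAdmissible_holds hcpt π).2 (principalCongruenceLevel n K 𝔫)
      (principalCongruenceLevel_mem_finiteLevelsGL_holds n K h𝔫)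
  -- the intertwiner `W^{K(𝔫)} → (W / W')^{K(𝔫)}`, `v ↦ [v]`
  have hfix : ∀ v : invW π h𝔫, π.mkQ (v : π.W) ∈ π.finiteRep.fixedPoints (levelFin n K hcpt 𝔫) := by
    intro v u
    obtain ⟨φ, hφ⟩ := v.2
    change π.finiteRep u (π.mkQ (v : π.W)) = π.mkQ (v : π.W)
    rw [← hφ, ← AutomorphicRepData.mkQ_finiteRepW, finiteRepW_levelProj π h𝔫 u.2]
  let jl : invW π h𝔫 →ₗ[ℂ] π.finiteRep.fixedPoints (levelFin n K hcpt 𝔫) :=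
    { toFun := fun v => ⟨π.mkQ (v : π.W), hfix v⟩
      map_add' := fun v w => Subtype.ext (by
        change π.mkQ ((v : π.W) + (w : π.W)) = π.mkQ (v : π.W) + π.mkQ (w : π.W)
        rw [map_add])
      map_smul' := fun c v => Subtype.ext (by
        change π.mkQ (c • (v : π.W)) = c • π.mkQ (v : π.W)
        rw [map_smul]) }
  let j : (invKRep π h𝔫).IntertwiningMap (π.kRepFixed (levelFin n K hcpt 𝔫)) :=
    jl.intertwiningMap_of_isIntertwiningMap _ _ fun k v => Subtype.ext rfl
  refine hadm.of_injective j fun v w hvw => ?_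
  have h1 : π.mkQ (v : π.W) = π.mkQ (w : π.W) := congrArg (fun x : π.finiteRep.fixedPoints _ => (x : π.Quot)) hvw
  exact Subtype.ext (mkQ_injective π hW' h1)

/-- `Z = 1` acts on `W^{K(𝔫)}` by the scalar by which it acts on `W`. [folklore] -/
theorem invLie_centerOne {μ : ℂ}
    (hμ : ∀ c ∈ π.W, lieDeriv (AutomorphyDatum.gl n K hcpt).ofArch (centerOne n K hcpt) c = μ • c)
    (v : invW π h𝔫) : invLie π h𝔫 (centerOne n K hcpt) v = μ • v :=
  Subtype.ext (Subtype.ext (hμ _ (v : π.W).2))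

set_option maxHeartbeats 400000 in
-- the datum's towers
/-- **`W^{K(𝔫)}` has the archimedean parameter of `π`** (`W' = ⊥`): the Lie algebra action on `W / W'`
has it by hypothesis, and `W^{K(𝔫)} → W → W / ⊥` is an injective intertwiner
(`HasArchParameter.of_injective`). [cite: Clozel1990, §3.3] -/
theorem hasArchParameter_invLie (hW' : π.W' = ⊥) {χ : (K →+* ℂ) → Multiset ℂ} (hχ : π.HasArchParameter χ) :
    Automorphic.HasArchParameter
      ((invLie π h𝔫).comp (LieSubalgebra.topEquiv :
        (⊤ : LieSubalgebra ℝ (Matrix (Fin n) (Fin n) (mixedSpace K))) ≃ₗ⁅ℝ⁆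
          Matrix (Fin n) (Fin n) (mixedSpace K)).symm.toLieHom) χ := by
  obtain ⟨ρ𝔤, hρ, hpar⟩ := hχ
  refine hpar.of_injective (π.mkQ ∘ₗ (invW π h𝔫).subtype) (fun X v => ?_)
    ((mkQ_injective π hW').comp Subtype.val_injective)
  change π.mkQ (π.lieDerivW _ (v : π.W)) = ρ𝔤 _ (π.mkQ (v : π.W))
  rw [hρ]

/-- **`W^{K(𝔫)}` is essentially unitary**: the unitarily normalised Petersson form of a clean cuspidal
`π` restricts to a positive definite Hermitian form on `W^{K(𝔫)}` for which every `X ∈ 𝔤` of norm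
exponent `∑_{v real} tr X_v + ∑_{v complex} 2 re tr X_v = 0` acts skew-adjointly.
[cite: Borel1997, 11.12 (2)] [cite: BorelJacquetCorvallis1979, 5.7] -/
theorem exists_isPosForm_invW [NeZero n] (hcusp : π.W ≤ cuspFormsGL n K hcpt) (hW' : π.W' = ⊥) :
    ∃ ip : invW π h𝔫 → invW π h𝔫 → ℂ, Kuga.IsPosForm ip ∧
      ∀ X : (AutomorphyDatum.gl n K hcpt).arch.lie,
        ((∑ w, (X : Matrix (Fin n) (Fin n) (mixedSpace K)).trace.1 w) +
            ∑ w, 2 * ((X : Matrix (Fin n) (Fin n) (mixedSpace K)).trace.2 w).re) = 0 →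
        ∀ v w : invW π h𝔫, ip (invLie π h𝔫 X v) w = -ip v (invLie π h𝔫 X w) := by
  obtain ⟨μ, hμ⟩ := AdelicGroupData.exists_isAutomorphicMeasure_gl_holds n K
  obtain ⟨T⟩ := π.nonempty_unitaryTwist hcusp hW'
  have hip := T.isPosForm_pet μ
  refine ⟨fun v w => T.pet μ (v : π.W) (w : π.W), ?_, fun X hX v w => T.pet_lieDerivW_left μ X hX _ _⟩
  exact
    { add_left := fun x y z => hip.add_left _ _ _
      smul_left := fun c x y => hip.smul_left _ _ _
      conj_symm := fun x y => hip.conj_symm _ _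
      nonneg := fun x => hip.nonneg _
      definite := fun x hx => Subtype.ext (hip.definite _ hx) }

end ConeDictionary

end Literature.NumberTheory.Automorphic

end
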